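import Summits.AtomisticToContinuum.BoseEinsteinCondensation.Theses.BECInsertionCorrector
import Summits.AtomisticToContinuum.BoseEinsteinCondensation.Theorems.CorrectorClosure.Negative.InsertionResidueLoadBearing
import Summits.AtomisticToContinuum.BoseEinsteinCondensation.Theorems.CorrectorClosure.Negative.InsertionResidueTorusPlaneWaves
import Literature.MathematicalPhysics.QuantumManyBody.PeriodicBoseGasTagged
import Literature.MathematicalPhysics.QuantumManyBody.PeriodicBoseGasThm31
import Literature.Barriers.AtomisticToContinuum.KineticGapLengthScalesThermodynamicWindow
import Literature.MathematicalPhysics.QuantumManyBody.PeriodicBoseGasCouplingPath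
import Literature.MathematicalPhysics.QuantumManyBody.FubiniStudyAngle
import Literature.MathematicalPhysics.QuantumManyBody.CouplingPathRigidity
import Literature.MathematicalPhysics.QuantumManyBody.CouplingPathArcChord
import Literature.MathematicalPhysics.QuantumManyBody.InsertionStateIdentities
import Literature.MathematicalPhysics.QuantumManyBody.CouplingPathSliceFloor
import Literature.MathematicalPhysics.QuantumManyBody.BosonicFloor

/-!
# Line `llp-fidelity-arc` for crux `CorrectorClosure` (stmt-AtomisticToContinuum-12058) — the lead's skeleton
(v4, reshaped by prover-line-stmt-AtomisticToContinuum-12058-0, 2026-08-16 02:45Z)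

Route `BECInsertionCorrector`; crux `CorrectorClosure := StaticResponseBound → InsertionResidue`.

**Idea (card `llp-fidelity-arc`, lab-frame typing).** The insertion residue of `InsertionResidue` is a
ground-state FIDELITY `Z_N = |⟨φ₀ ⊗ Θ_N, Ψ_{N+1}⟩|²` between the decoupled tagged Hamiltonian
`H₀ = -Δ₀ + H_N(bath)` and the coupled one `H₁ = H₀ + ∑ⱼ v^per(xⱼ - x₀)`. Switch the impurity–bath
coupling on along the ceiling path `u_λ = min(v, λ/(1-λ))` and bound the Fubini–Study LENGTH of the
near-minimiser path: arc ≥ chord gives `Z_N ≥ cos²(length)`; the length is `∫₀¹ √χ_F`, first-order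
responses only; `ρ < ρ₀` buys smallness of the arc.

**Objects.** `couplingHeight`, `couplingProfile`, `coupledEnergy`, `coupledGroundStateEnergy`,
`taggedInner`, `fsAngle`, `insertionState` and their API are the Literature definition file
`Literature/MathematicalPhysics/QuantumManyBody/PeriodicBoseGasCouplingPath.lean` (proposal p71739 of
this seat, ACCEPTED 2026-08-16T00:12Z, imported above). The near-minimiser window and the local metric-speed bound are INLINED in the statements
(no `Prop`-valued definition anywhere in the line):
* "`Ψ` is a `δ`-near-minimiser at coupling `λ`": `coupledEnergy v λ Ψ ≤ coupledGroundStateEnergy v λ N L + δ`;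
* "local speed bound at the node `λ` with majorant `s`":
  `∃ η > 0, ∀ λ' ∈ [0,1], λ' ≠ λ, |λ' - λ| < η → ∃ δ > 0, ∀ Ψ Ψ'` (`δ`-near-minimisers at `λ`, `λ'`),
  `fsAngle Ψ Ψ' ≤ ∫_{uIcc λ λ'} s` (`δ` AFTER `λ'`: near-minimisers at a fixed coupling are only
  asymptotically parallel — this silently contains ground-state uniqueness at fixed `(N, L)`).

**Stubs (6 registered in v2; 4 LANDED in wave 1, 2 open — v1 had 4, `stub_endpoints` was split into (a) / (b) / (c,d)).**
* `stub_bosonicFloor` (L): `E₀^per(N+1, L) ≤ E_{κ=1}(N, L)` — bosonic = absolute ground-state energy.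
  PF-free proof available: symmetrise `F = avg_σ |f∘σ|²` over `S_{N+1}`, regularise
  `g_ε = √(ε² + F) − ε` (C¹, symmetric, `g_ε² ≤ F`, `|∇g_ε|² ≤ avg_σ |∇(f∘σ)|²` by Cauchy–Schwarz),
  monotone convergence `‖g_ε‖² ↑ 1`.
* `stub_sliceFloor` (M–L): `E₀^per(N, L) ≤ E_{λ=0}(N, L)` — slice a tagged state at fixed `x₀`,
  normalise the slice (`PeriodicTrialState.ofFun`), drop `|∇₀Ψ|²`, Tonelli (`setLIntegral_cellN_succ_left`).
* `stub_insertionStateIdentities` (M): `⟨φ₀⊗Θ, H₀ φ₀⊗Θ⟩ = periodicEnergy v Θ` (product computation,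
  `u₀ = 0`, `∇φ₀ = 0`) and `|⟨φ₀⊗Θ, Ψ⟩|² = L⁻³|∫ conj Θ ∫_cell Ψ(x,·)dx|²` (Fubini).
* `stub_arcChord` (M–L): arc ≥ chord — an integrable local speed majorant at every node of `[0,1]`
  (plus finite coupled energies) puts the endpoint rays within FS distance `∫₀¹ s` for ONE common `δ`
  (FS triangle inequality on rays of `L²(cell^{N+1})` + sup-of-reachable-points chain + finite min of `δ`s).
* v4 RESHAPE (2026-08-16, lead): the two physics stubs of v2/v3 (`stub_undressedSpeed`,
  `stub_dressedPathBound`, universal over near-minimisers) are split along the seam the disprover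
  exposed (hidden input = uniqueness + gap of the ground ray at fixed `(N,L)`):
  - `stub_nearMinimiserRigidity` (G, L): at low density, eventually in `N`, at every `λ ∈ [0,1]` the
    `δ`-near-minimisers of `coupledEnergy v λ` collapse to ONE ray as `δ → 0` (fixed-volume spectral
    frame; shared in substance by all lines of the crux);
  - `stub_undressedSpeedExists` (A∃, L→XL): K1 ⇒ arbitrarily accurate near-minimiser pairs at `0` and
    `λ'` within angle `θλ'` (the chord of the ground-ray path; exact recoil + `StaticResponseToHMinusOne`);
  - `stub_dressedPathExists` (D∃, XL, HARDEST, held by the lead): K1 + (G) + (A∃) ⇒ an integrable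
    existential majorant `s ≥ 0`, `∫₀¹ s ≤ θ`, at EVERY node (dressed recoil) — a CONSTRUCTIVE dressed
    family along the path would prove it;
  and the passage (G) + (D∃) ⇒ universal local speed bounds with the floored majorant `s + c` is
  PROVED (`forall_fsAngle_le_of_rigidity`, `localSpeedBound_of_rigidity`, FS triangle inequality;
  landed as Literature `CouplingPathRigidity.lean`, p76469).

Composition `CorrectorClosure_of : CorrectorClosure` is sorry-free and uses the seven stubs BY NAME.
Disproof.lean gen 2 obligations honoured as in v1: K1 consumed in `stub_undressedSpeed`/`stub_dressedPathBound`;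
window on `Ψ` kept (Negative `insertionResidue_false_without_window`); finiteness `E₀^per(N+1,L_N) < ⊤`
DISCHARGED by `exists_eventually_periodicGroundStateEnergy_lt_top`; `δ` produced after `N` (§7); `c = cos² 1 < 1` (§5/§8).
-/

noncomputable section

open MeasureTheory Filter
open scoped ENNReal NNReal ComplexConjugate


namespace Summit.AtomisticToContinuum.BoseEinsteinCondensation.Cruxes.CorrectorClosure.LlpFidelityArc

open Literature.MathematicalPhysics.QuantumManyBody.BoseGas
open Summit.AtomisticToContinuum.BoseEinsteinCondensation.Theses.BECInsertionCorrector

/-! ## The four LANDED stubs, re-derived here from their Literature sources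
(identical statements and proofs to the landed Theorems files `BECInsertionCorrectorCorrectorClosure*.lean`,
namespace `…Theorems.CorrectorClosure.LlpFidelityArc`; re-derived rather than imported so that this work
file elaborates independently of the farm's build state of Summits-side modules). -/
namespace Llp

/-- = landed `stub_bosonicFloor` (p75750). [folklore] -/
theorem stub_bosonicFloor :
    ∀ (v : ℝ → ℝ≥0∞), IsRepulsiveFiniteRange v → ∀ (N : ℕ) (L : ℝ), 0 < L →
      periodicGroundStateEnergy v (N + 1) L ≤ taggedPeriodicGroundStateEnergy v 1 N L :=
  fun _ hv N L _ => periodicGroundStateEnergy_succ_le_taggedPeriodicGroundStateEnergy_one hv.1 N L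

/-- = landed `stub_sliceFloor` (p73962). [folklore] -/
theorem stub_sliceFloor :
    ∀ (v : ℝ → ℝ≥0∞), IsRepulsiveFiniteRange v → ∀ (N : ℕ) (L : ℝ), 0 < L →
      periodicGroundStateEnergy v N L ≤ coupledGroundStateEnergy v 0 N L :=
  fun _ hv N L _ => periodicGroundStateEnergy_le_coupledGroundStateEnergy_zero hv.1 N L

/-- = landed `stub_insertionStateIdentities` (p73254). [folklore] -/
theorem stub_insertionStateIdentities :
    ∀ (v : ℝ → ℝ≥0∞), IsRepulsiveFiniteRange v → ∀ (N : ℕ) (L : ℝ) (hL : 0 < L),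
      (∀ Θ : PeriodicTrialState N L, coupledEnergy v 0 (insertionState hL Θ) = periodicEnergy v Θ) ∧
      (∀ (Θ : PeriodicTrialState N L) (Ψ : PeriodicTrialState (N + 1) L),
        ((‖taggedInner (insertionState hL Θ) Ψ.toTagged‖₊ : ℝ≥0∞) ^ 2) =
          ENNReal.ofReal ((L ^ 3)⁻¹) *
            (‖∫ X in cellN N L, conj (Θ.ψ X) *
                ∫ x in cell L, Ψ.ψ (Matrix.vecCons x X)‖₊ : ℝ≥0∞) ^ 2) :=
  fun _ hv _ _ hL =>
    ⟨fun Θ => coupledEnergy_zero_insertionState hv.1 hL Θ,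
      fun Θ Ψ => nnnorm_taggedInner_insertionState_sq hL Θ Ψ⟩

/-- = landed `stub_arcChord` (p74259). [folklore] -/
theorem stub_arcChord :
    ∀ (v : ℝ → ℝ≥0∞) (N : ℕ) (L : ℝ) (s : ℝ → ℝ),
      IntegrableOn s (Set.Icc (0 : ℝ) 1) → (∀ t, 0 ≤ s t) →
      (∀ lam ∈ Set.Icc (0 : ℝ) 1, coupledGroundStateEnergy v lam N L ≠ ⊤) →
      (∀ lam ∈ Set.Icc (0 : ℝ) 1,
        ∃ η : ℝ, 0 < η ∧ ∀ lam' ∈ Set.Icc (0 : ℝ) 1, lam' ≠ lam → |lam' - lam| < η →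
          ∃ δ : ℝ≥0∞, 0 < δ ∧ ∀ Ψ Ψ' : TaggedPeriodicTrialState N L,
            coupledEnergy v lam Ψ ≤ coupledGroundStateEnergy v lam N L + δ →
            coupledEnergy v lam' Ψ' ≤ coupledGroundStateEnergy v lam' N L + δ →
              fsAngle Ψ Ψ' ≤ ∫ t in Set.uIcc lam lam', s t) →
      ∃ δ : ℝ≥0∞, 0 < δ ∧ ∀ Ψ₀ Ψ₁ : TaggedPeriodicTrialState N L,
        coupledEnergy v 0 Ψ₀ ≤ coupledGroundStateEnergy v 0 N L + δ →
        coupledEnergy v 1 Ψ₁ ≤ coupledGroundStateEnergy v 1 N L + δ →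
          fsAngle Ψ₀ Ψ₁ ≤ ∫ t in Set.Icc (0 : ℝ) 1, s t :=
  fun v N L s hs _ _ hloc => fsAngle_endpoints_le_integral_of_local_speed_bound v N L s hs hloc

end Llp

/-! ## Registered stubs

LANDED (2026-08-16, wave 1; Theorems files `BECInsertionCorrectorCorrectorClosure*.lean`, namespace
`…Theorems.CorrectorClosure.LlpFidelityArc`; re-derived below from their Literature sources):
`stub_bosonicFloor` (p75750; Literature `BosonicFloor`, `BosonicFloorSymmetrisation`,
`PeriodicBoseGasRelabelling`), `stub_sliceFloor` (p73962; Literature `CouplingPathSliceFloor`),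
`stub_insertionStateIdentities` (p73254; Literature `InsertionStateIdentities`), `stub_arcChord`
(p74259; Literature `FubiniStudyAngle`, `CouplingPathArcChord`).
OPEN (the ONLY `sorry`s of the line, v4): `stub_nearMinimiserRigidity` (G), `stub_undressedSpeedExists`
(A∃), `stub_dressedPathExists` (D∃, hardest, held by the lead). -/

/-- **Stub (G) — near-minimiser rigidity at fixed `(N, L)` (L; the fixed-volume spectral frame,
shared in substance by every line of this crux).** For a repulsive finite-range `v`, at low density
and for all large `N` (torus of side `L = ((N+1)/ρ)^{1/3}`): at EVERY coupling `λ ∈ [0,1]` the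
`δ`-near-minimisers of the coupled tagged energy `coupledEnergy v λ` collapse to ONE ray as
`δ → 0` — for every `ε > 0` there is `δ > 0` such that any two `δ`-near-minimisers are within
Fubini–Study angle `ε`. Content: (i) the ground-state energy `E_λ(N,L)` is finite (Ruelle, low
density, eventually) — otherwise every state is a near-minimiser and the claim is false (hard
spheres jam at high density: Disproof §10); (ii) the form of `H_λ` on bath-symmetric periodic
functions has compact resolvent (torus Rellich) so `E_λ = inf σ` is an isolated eigenvalue and
`⟨Ψ,(H_λ − E_λ)Ψ⟩ ≥ gap · ‖P^⊥Ψ‖²`; (iii) the eigenvalue is SIMPLE: the absolute ground state of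
`H_λ` is strictly positive (positivity-improving Feynman–Kac flow, Reed–Simon XIII.44 /
`pfkL2_perronFrobenius` pattern of the tree for bounded `v^per`; for hard / `⊤`-valued cores the
all-free component of the configuration space is the unique lowest one at low density and is
connected), hence bath-symmetric, so the tagged infimum sees it; (iv) the `C¹` periodic core is a
form core. Why it might fail: only (iii) for `⊤`-valued `v` (connectivity of the dilute hard-core
configuration space at fixed large `N`). [cite: ReedSimonIV1978, Thm XIII.44 and Thm XIII.47; ChungZhao1995 Thm 3.10] -/
theorem stub_nearMinimiserRigidity :
    ∀ (v : ℝ → ℝ≥0∞), IsRepulsiveFiniteRange v →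
      ∃ ρ₀ : ℝ, 0 < ρ₀ ∧ ∀ ρ : ℝ, 0 < ρ → ρ < ρ₀ → ∀ᶠ N : ℕ in atTop,
        ∀ lam ∈ Set.Icc (0 : ℝ) 1, ∀ ε : ℝ, 0 < ε →
          ∃ δ : ℝ≥0∞, 0 < δ ∧ ∀ Ψ Ψ' : TaggedPeriodicTrialState N (sideLength ρ (N + 1)),
            coupledEnergy v lam Ψ ≤ coupledGroundStateEnergy v lam N (sideLength ρ (N + 1)) + δ →
            coupledEnergy v lam Ψ' ≤ coupledGroundStateEnergy v lam N (sideLength ρ (N + 1)) + δ →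
              fsAngle Ψ Ψ' ≤ ε := by
  sorry

/-- **Stub (A∃) — undressed speed, existential form (L→XL; the K1 anchor, exact recoil).** Given
K1 (`StaticResponseBound`), for every repulsive finite-range `v` and every slope `θ > 0` there is
`ρ₀` such that for `ρ < ρ₀` and all large `N` (torus `L = ((N+1)/ρ)^{1/3}`, `N` bath particles):
for all couplings `λ' ≠ 0` below some `η > 0` there are ARBITRARILY ACCURATE near-minimisers at
`λ = 0` and at `λ'` within Fubini–Study angle `θ·λ'` of each other (the chord of the ground-ray
path leaves the decoupled end with slope `≤ θ`; with Stub (G) this is the universal local speed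
bound of v2's `stub_undressedSpeed`). Mechanism: at `λ = 0` the tangent `∂_λ H_λ = n_S` (ceiling
path; Born factor = support indicator, bounded even for hard cores) splits into bath density modes
times impurity plane waves, on which `H₀ − E₀ = (H_N − E_N) + k²` EXACTLY; `(ω + k²)⁻² ≤ (4ωk²)⁻¹`
turns `χ_F(0)` into K1's `m₋₁` via `StaticResponseToHMinusOne` at bath density `ρN/(N+1)`
(`sideLength (ρN/(N+1)) N = sideLength ρ (N+1)`): `χ_F(0) = O_v(C|S|²√(ρ/a))` uniformly in `N`
(IR-finite only thanks to the `ρa` floor of K1; `= ∞` in `d = 1`); then fixed-`N` second-order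
perturbation of the ground ray (gap + uniqueness = Stub (G) at `λ = 0` and small `λ'`; `η` may
depend on `N`). Finite range is load-bearing (Negative `UndressedAnchorLoadBearing`: with
`Measurable v` only the statement is `↔ ¬ StaticResponseBound`).
[cite: GuentherEtAl2021, eqs. (3) and (10); KipnisLandim1999 App. 1 §6 (6.1)] -/
theorem stub_undressedSpeedExists :
    StaticResponseBound → ∀ (v : ℝ → ℝ≥0∞), IsRepulsiveFiniteRange v →
      ∀ θ : ℝ, 0 < θ → ∃ ρ₀ : ℝ, 0 < ρ₀ ∧ ∀ ρ : ℝ, 0 < ρ → ρ < ρ₀ → ∀ᶠ N : ℕ in atTop,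
        ∃ η : ℝ, 0 < η ∧ ∀ lam' ∈ Set.Icc (0 : ℝ) 1, lam' ≠ 0 → |lam' - 0| < η →
          ∀ δ : ℝ≥0∞, 0 < δ → ∃ Ψ Ψ' : TaggedPeriodicTrialState N (sideLength ρ (N + 1)),
            coupledEnergy v 0 Ψ ≤ coupledGroundStateEnergy v 0 N (sideLength ρ (N + 1)) + δ ∧
            coupledEnergy v lam' Ψ' ≤ coupledGroundStateEnergy v lam' N (sideLength ρ (N + 1)) + δ ∧
              fsAngle Ψ Ψ' ≤ θ * lam' := by
  sorry

/-- **Stub (D∃) — dressed path, existential form (XL, HARDEST; Transfer target `C⁺`).** Given K1,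
the rigidity frame (G) and the undressed anchor (A∃) for `v`, the WHOLE coupled path is short at low
density: for every `θ > 0`, eventually in `N`, there is an integrable majorant `s ≥ 0` on `[0,1]`
with `∫₀¹ s ≤ θ` such that at every node `λ`, for all `λ' ≠ λ` below some `η(λ) > 0`, there are
ARBITRARILY ACCURATE near-minimisers at `λ` and at `λ'` within Fubini–Study angle `∫_{[λ,λ']} s`
(the ground-ray path has metric speed `≤ s`; with (G) this is v2's universal `stub_dressedPathBound`
up to a floor — see `localSpeedBound_of_rigidity`). For exact ground states `s = √χ_F`,
`χ_F(λ) = ‖(H_λ − E_λ)⁻¹ Q ∂_λH_λ Ψ_λ‖²`, an `ω⁻²` response of ONE impurity-dressed ground state at a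
time; its `ω⁻¹` half `−E''(λ)/2` integrates for free by concavity; the missing input is DRESSED
RECOIL (an operator-level substitute at `λ > 0` for the exact sector identity of `λ = 0`). One-loop
calibration (Disproof §15): with the dressed vertex the arc is the Bogoliubov depletion,
`arc² = (8/(3√π))√(ρa³)`, no `log L` at two-phonon order; the Born-level arc is `∝ (ρ/a)^{1/4}‖v‖₁`,
INFINITE for hard cores — dressing is the content already at one loop. Existential in the states:
a CONSTRUCTIVE family of dressed trial states along the path with controlled energies AND controlled
Fubini–Study increments would prove it outright.
[cite: LampartTriay2025, (Bogoliubov–Fröhlich dressing; heuristics only); GuentherEtAl2021, eq. (10)] -/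
theorem stub_dressedPathExists :
    StaticResponseBound → ∀ (v : ℝ → ℝ≥0∞), IsRepulsiveFiniteRange v →
      (∃ ρ₀ : ℝ, 0 < ρ₀ ∧ ∀ ρ : ℝ, 0 < ρ → ρ < ρ₀ → ∀ᶠ N : ℕ in atTop,
        ∀ lam ∈ Set.Icc (0 : ℝ) 1, ∀ ε : ℝ, 0 < ε →
          ∃ δ : ℝ≥0∞, 0 < δ ∧ ∀ Ψ Ψ' : TaggedPeriodicTrialState N (sideLength ρ (N + 1)),
            coupledEnergy v lam Ψ ≤ coupledGroundStateEnergy v lam N (sideLength ρ (N + 1)) + δ →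
            coupledEnergy v lam Ψ' ≤ coupledGroundStateEnergy v lam N (sideLength ρ (N + 1)) + δ →
              fsAngle Ψ Ψ' ≤ ε) →
      (∀ θ : ℝ, 0 < θ → ∃ ρ₀ : ℝ, 0 < ρ₀ ∧ ∀ ρ : ℝ, 0 < ρ → ρ < ρ₀ → ∀ᶠ N : ℕ in atTop,
        ∃ η : ℝ, 0 < η ∧ ∀ lam' ∈ Set.Icc (0 : ℝ) 1, lam' ≠ 0 → |lam' - 0| < η →
          ∀ δ : ℝ≥0∞, 0 < δ → ∃ Ψ Ψ' : TaggedPeriodicTrialState N (sideLength ρ (N + 1)),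
            coupledEnergy v 0 Ψ ≤ coupledGroundStateEnergy v 0 N (sideLength ρ (N + 1)) + δ ∧
            coupledEnergy v lam' Ψ' ≤ coupledGroundStateEnergy v lam' N (sideLength ρ (N + 1)) + δ ∧
              fsAngle Ψ Ψ' ≤ θ * lam') →
      ∀ θ : ℝ, 0 < θ →
      ∃ ρ₀ : ℝ, 0 < ρ₀ ∧ ∀ ρ : ℝ, 0 < ρ → ρ < ρ₀ → ∀ᶠ N : ℕ in atTop,
        ∃ s : ℝ → ℝ, IntegrableOn s (Set.Icc (0 : ℝ) 1) ∧ (∀ t, 0 ≤ s t) ∧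
          (∫ t in Set.Icc (0 : ℝ) 1, s t) ≤ θ ∧
          ∀ lam ∈ Set.Icc (0 : ℝ) 1,
            ∃ η : ℝ, 0 < η ∧ ∀ lam' ∈ Set.Icc (0 : ℝ) 1, lam' ≠ lam → |lam' - lam| < η →
              ∀ δ : ℝ≥0∞, 0 < δ → ∃ Ψ Ψ' : TaggedPeriodicTrialState N (sideLength ρ (N + 1)),
                coupledEnergy v lam Ψ ≤ coupledGroundStateEnergy v lam N (sideLength ρ (N + 1)) + δ ∧
                coupledEnergy v lam' Ψ' ≤
                  coupledGroundStateEnergy v lam' N (sideLength ρ (N + 1)) + δ ∧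
                  fsAngle Ψ Ψ' ≤ ∫ t in Set.uIcc lam lam', s t := by
  sorry

/-! ## From rigidity + existential closeness to the universal local speed bound
PROVED and LANDED: `forall_fsAngle_le_of_rigidity`, `localSpeedBound_of_rigidity` in
`Literature/MathematicalPhysics/QuantumManyBody/CouplingPathRigidity.lean` (p76469, imported above). -/

/-! ## Composition (sorry-free): the seven stubs give the crux BY NAME -/

/-- **`CorrectorClosure` from the registered stubs** (kernel-checked glue, no `sorry` of its own).
Given K1: rigidity frame (G) and anchor (A∃) ⇒ an existential dressed majorant `s` with
`∫₀¹ s ≤ 1/2` eventually (D∃) ⇒ the universal local speed bound with the floored majorant `s + 1/2`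
at every node (`localSpeedBound_of_rigidity`) ⇒ endpoint rays within angle `∫₀¹ (s + 1/2) ≤ 1` for
one common `δ` (`stub_arcChord`) ⇒ with `Θ` any `δ`-near-minimiser of the bath (exists:
`E₀^per(N) ≤ E_{λ=0} ≤ E₀^per(N+1) < ⊤`, `stub_sliceFloor` + Ruelle finiteness) and `Ψ` any
`δ`-near-minimiser of the `(N+1)`-body energy (a tagged near-minimiser at `λ = 1` by
`stub_bosonicFloor`), the fidelity is `≥ cos 1`, i.e. `Z_N ≥ cos² 1 > 0` by
`stub_insertionStateIdentities`. [folklore] -/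
theorem CorrectorClosure_of :
    Summit.AtomisticToContinuum.BoseEinsteinCondensation.Theses.BECInsertionCorrector.CorrectorClosure := by
  intro hK v hv
  obtain ⟨ρG, hρG, hrigid⟩ := stub_nearMinimiserRigidity v hv
  have hanchor := stub_undressedSpeedExists hK v hv
  obtain ⟨ρA, hρA, hpath⟩ :=
    stub_dressedPathExists hK v hv ⟨ρG, hρG, hrigid⟩ hanchor (1 / 2) (by norm_num)
  obtain ⟨ρ₁, hρ₁, hfinE⟩ :=
    Literature.Barriers.AtomisticToContinuum.BoseGas.exists_eventually_periodicGroundStateEnergy_lt_top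
      hv
  refine ⟨min (min ρA ρG) ρ₁, lt_min (lt_min hρA hρG) hρ₁, fun ρ hρ hρlt => ?_⟩
  have hρA' : ρ < ρA := lt_of_lt_of_le hρlt ((min_le_left _ _).trans (min_le_left _ _))
  have hρG' : ρ < ρG := lt_of_lt_of_le hρlt ((min_le_left _ _).trans (min_le_right _ _))
  have hρ₁' : ρ < ρ₁ := lt_of_lt_of_le hρlt (min_le_right _ _)
  have hcos : 0 < Real.cos 1 :=
    Real.cos_pos_of_mem_Ioo ⟨by linarith [Real.pi_gt_three], by linarith [Real.pi_gt_three]⟩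
  refine ⟨Real.cos 1 ^ 2, pow_pos hcos 2, ?_⟩
  have hfin1 : ∀ᶠ N : ℕ in atTop,
      periodicGroundStateEnergy v (N + 1) (sideLength ρ (N + 1)) < ⊤ :=
    (tendsto_add_atTop_nat 1).eventually (hfinE ρ hρ hρ₁')
  filter_upwards [hpath ρ hρ hρA', hrigid ρ hρ hρG', hfin1] with N hN hrigN hfinN
  obtain ⟨s, hs, hs0, hstot, hloc⟩ := hN
  set L := sideLength ρ (N + 1) with hLdef
  have hL : 0 < L := sideLength_pos_of_pos hρ (Nat.succ_pos N)
  have hPF := Llp.stub_bosonicFloor v hv N L hL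
  have hslice := Llp.stub_sliceFloor v hv N L hL
  obtain ⟨hprod, hov⟩ := Llp.stub_insertionStateIdentities v hv N L hL
  -- the floored majorant `s + 1/2` is a UNIVERSAL local speed majorant at every node
  have hs' : IntegrableOn (fun t => s t + 1 / 2) (Set.Icc (0 : ℝ) 1) :=
    hs.add (integrableOn_const (by rw [Real.volume_Icc]; exact ENNReal.ofReal_ne_top))
  have hs'0 : ∀ t, 0 ≤ s t + 1 / 2 := fun t => by linarith [hs0 t]
  have hs'tot : (∫ t in Set.Icc (0 : ℝ) 1, (s t + 1 / 2)) ≤ 1 := by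
    have hcI : IntegrableOn (fun _ : ℝ => (1 / 2 : ℝ)) (Set.Icc (0 : ℝ) 1) :=
      integrableOn_const (by rw [Real.volume_Icc]; exact ENNReal.ofReal_ne_top)
    rw [integral_add hs hcI, setIntegral_const, measureReal_def, Real.volume_Icc, sub_zero,
      ENNReal.toReal_ofReal zero_le_one, smul_eq_mul, one_mul]
    linarith
  have hloc' : ∀ lam ∈ Set.Icc (0 : ℝ) 1,
      ∃ η : ℝ, 0 < η ∧ ∀ lam' ∈ Set.Icc (0 : ℝ) 1, lam' ≠ lam → |lam' - lam| < η →
        ∃ δ : ℝ≥0∞, 0 < δ ∧ ∀ Ψ Ψ' : TaggedPeriodicTrialState N L,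
          coupledEnergy v lam Ψ ≤ coupledGroundStateEnergy v lam N L + δ →
          coupledEnergy v lam' Ψ' ≤ coupledGroundStateEnergy v lam' N L + δ →
            fsAngle Ψ Ψ' ≤ ∫ t in Set.uIcc lam lam', (s t + 1 / 2) := by
    intro lam hlam
    obtain ⟨η, hη, hex⟩ := hloc lam hlam
    exact localSpeedBound_of_rigidity hs (by norm_num) hlam hη hrigN hex
  have hfinAll : ∀ lam ∈ Set.Icc (0 : ℝ) 1, coupledGroundStateEnergy v lam N L ≠ ⊤ :=
    fun lam _ => ne_top_of_le_ne_top hfinN.ne (coupledGroundStateEnergy_le_periodic v lam N _)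
  obtain ⟨δ, hδ, hchord⟩ := Llp.stub_arcChord v N L (fun t => s t + 1 / 2) hs' hs'0 hfinAll hloc'
  have hEN : periodicGroundStateEnergy v N L ≠ ⊤ :=
    ne_top_of_le_ne_top hfinN.ne (hslice.trans (coupledGroundStateEnergy_le_periodic v 0 N _))
  obtain ⟨Θ, hΘ⟩ : ∃ Θ : PeriodicTrialState N L,
      periodicEnergy v Θ < periodicGroundStateEnergy v N L + δ :=
    iInf_lt_iff.mp (ENNReal.lt_add_right hEN hδ.ne')
  refine ⟨δ, hδ, Θ, hΘ.le, fun Ψ hΨ => ?_⟩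
  have hΘnear : coupledEnergy v 0 (insertionState hL Θ) ≤ coupledGroundStateEnergy v 0 N L + δ := by
    rw [hprod Θ]
    exact hΘ.le.trans (add_le_add hslice le_rfl)
  have hΨnear : coupledEnergy v 1 Ψ.toTagged ≤ coupledGroundStateEnergy v 1 N L + δ := by
    rw [coupledEnergy_one_toTagged, coupledGroundStateEnergy_one]
    exact hΨ.trans (add_le_add hPF le_rfl)
  have hangle : fsAngle (insertionState hL Θ) Ψ.toTagged ≤ 1 :=
    (hchord _ _ hΘnear hΨnear).trans hs'tot
  rw [← hov Θ Ψ, coe_nnnorm_sq_eq_ofReal]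
  refine ENNReal.ofReal_le_ofReal ?_
  set x : ℝ := ‖taggedInner (insertionState hL Θ) Ψ.toTagged‖ with hx
  have hx0 : 0 ≤ x := norm_nonneg _
  have hangle' : Real.arccos x ≤ 1 := hangle
  rcases le_or_gt x 1 with hx1 | hx1
  · have hcosle : Real.cos 1 ≤ x := by
      have h := Real.cos_le_cos_of_nonneg_of_le_pi (Real.arccos_nonneg x)
        (by linarith [Real.pi_gt_three]) hangle'
      rwa [Real.cos_arccos (by linarith) hx1] at h
    nlinarith [mul_nonneg (sub_nonneg.2 hcosle) (add_nonneg hx0 hcos.le)]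
  · have h1 : Real.cos 1 ^ 2 ≤ 1 := Real.cos_sq_le_one 1
    nlinarith [sq_nonneg (x - 1)]

end Summit.AtomisticToContinuum.BoseEinsteinCondensation.Cruxes.CorrectorClosure.LlpFidelityArc

end
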